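import Literature.NumberTheory.GaloisRepresentations.SemiLocalUnits
import Literature.NumberTheory.GaloisRepresentations.ArchimedeanHerbrand
import Literature.NumberTheory.GaloisRepresentations.UnitIdeles
import HarnessLib

/-!
# The idele group of a cyclic extension as a `Gal`-module: local blocks and their Herbrand quotients

Topic `NumberTheory/GaloisRepresentations` (class field theory: the idelic computation of
Childress, *Class Field Theory*, Ch. 4 §5, towards the global cyclic norm index inequality,
Thm. 5.12); namespace `Literature.NumberTheory.GaloisRepresentations.IdeleHerbrand`.
Definitions with their API; everything **proved**.

For a finite Galois extension of number fields `E/F` with group `G` acting on the idele group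
`J_E = 𝔸_Eˣ` (`ClassFieldCharacter.lean`: `(σ • x)_w = σ (x_{σ⁻¹ w})`), and a finite place `v` of
`F`:

* `IdeleHerbrand.blockHom F E v : J_E →* (∏_{w ∣ v} E_w)ˣ` — the `G`-equivariant projection to the
  semi-local block at `v` (`SemiLocalUnits.lean`), and `IdeleHerbrand.ofBlock` — the idele with a
  prescribed block of local units above `v` and `1` elsewhere (`blockHom ∘ ofBlock = id`);
* `IdeleHerbrand.localUnitIdeles F E v ≤ J_E` — Childress's `∏_{w ∣ v} 𝒰_w ⊆ J_E` (ideles `1` at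
  infinity and at the finite places not above `v`, local units above `v`), `G`-stable, equal to
  `ofBlock (SemiLocal.unitGroup)`, on which `blockHom` is injective; hence
  **`h0_localUnitIdeles_eq`, `h1_localUnitIdeles_eq`**: its `Ĥ⁰`/`Ĥ⁻¹` indices are those of
  `SemiLocal.unitGroup F E v` (`Herbrand.h0_map_eq`), so equal to each other and non-zero for
  cyclic `G` (`h0_localUnitIdeles_eq_h1`, from `SemiLocal.h0_unitGroup_eq_h1` — Childress
  Prop. 5.7 (i) inside `J_E`);
* `IdeleHerbrand.infIdeles E ≤ J_E` — the ideles trivial at all finite places (the image of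
  `(E_∞)ˣ`), `G`-stable, with **`h0_infIdeles_eq`, `h1_infIdeles_eq`** transporting to the whole of
  `(E_∞)ˣ` with its action of `ArchimedeanHerbrand.lean`.

## References

* N. Childress, *Class Field Theory*, Universitext, Springer 2009, Ch. 4 §5 Prop. 5.7 and the
  discussion before Lemma 5.1 (PDF pp. 89–92, 98). [Childress2009]
* J. W. S. Cassels, A. Fröhlich (eds.), *Algebraic Number Theory* (1967), Ch. VII (Tate) §1–§2.
  [CasselsFrohlichANT1967]
-/

noncomputable section

open NumberField IsDedekindDomain
open scoped Valued

namespace Literature.NumberTheory.GaloisRepresentations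

namespace IdeleHerbrand

open Literature.NumberTheory.Automorphic

universe u

variable (F : Type u) [Field F] [NumberField F] (E : Type u) [Field E] [NumberField E] [Algebra F E]
variable (v : HeightOneSpectrum (𝓞 F))

/-! ### Components -/

variable {F E v}

/-- Finite components of a product of ideles. [folklore] -/
theorem snd_mul_apply (x y : ideleGroup E) (w : HeightOneSpectrum (𝓞 E)) :
    ((x * y : ideleGroup E) : AdeleRing (𝓞 E) E).2 w =
      (x : AdeleRing (𝓞 E) E).2 w * (y : AdeleRing (𝓞 E) E).2 w := rfl

/-- Finite components of the inverse of an idele. [folklore] -/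
theorem snd_inv_apply (x : ideleGroup E) (w : HeightOneSpectrum (𝓞 E)) :
    ((x⁻¹ : ideleGroup E) : AdeleRing (𝓞 E) E).2 w = ((x : AdeleRing (𝓞 E) E).2 w)⁻¹ :=
  ideleGroup_val_inv_snd x w

/-- Finite components of an idele are non-zero. [folklore] -/
theorem snd_apply_ne_zero (x : ideleGroup E) (w : HeightOneSpectrum (𝓞 E)) :
    (x : AdeleRing (𝓞 E) E).2 w ≠ 0 := fun h0 => by
  have h := snd_mul_apply x x⁻¹ w
  rw [mul_inv_cancel, h0, zero_mul] at h
  exact one_ne_zero h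

omit [NumberField F] in
/-- Finite components of `σ • x`: `(σ • x)_w = σ (x_{σ⁻¹ w})`. [cite: CasselsFrohlichANT1967, Ch. VII §1.1] -/
theorem snd_smul_apply (σ : E ≃ₐ[F] E) (x : ideleGroup E) (w : HeightOneSpectrum (𝓞 E)) :
    ((σ • x : ideleGroup E) : AdeleRing (𝓞 E) E).2 w =
      galAdicCompletionMap σ (smul_inv_smul σ w) ((x : AdeleRing (𝓞 E) E).2 (σ⁻¹ • w)) := rfl

omit [NumberField F] in
/-- Infinite part of `σ • x`. [folklore] -/
theorem fst_smul (σ : E ≃ₐ[F] E) (x : ideleGroup E) :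
    ((σ • x : ideleGroup E) : AdeleRing (𝓞 E) E).1 = σ • (x : AdeleRing (𝓞 E) E).1 := rfl

variable (F E v)

/-! ### The block projection `J_E → (∏_{w ∣ v} E_w)ˣ` -/

/-- The ring homomorphism `𝔸_E → ∏_{w ∣ v} E_w` (finite components above `v`). [folklore] -/
def blockRingHom : AdeleRing (𝓞 E) E →+* SemiLocal F E v where
  toFun x w := x.2 (w : HeightOneSpectrum (𝓞 E))
  map_one' := rfl
  map_mul' _ _ := rfl
  map_zero' := rfl
  map_add' _ _ := rfl

/-- **The block projection** `J_E →* (∏_{w ∣ v} E_w)ˣ`. [folklore] -/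
def blockHom : ideleGroup E →* (SemiLocal F E v)ˣ := Units.map (blockRingHom F E v).toMonoidHom

variable {F E v}

omit [NumberField F] in
/-- Components of the block projection. [folklore] -/
@[simp] theorem blockHom_apply (x : ideleGroup E) (w : SemiLocal.Place F E v) :
    ((blockHom F E v x : (SemiLocal F E v)ˣ) : SemiLocal F E v) w =
      (x : AdeleRing (𝓞 E) E).2 (w : HeightOneSpectrum (𝓞 E)) := rfl

/-- **The block projection is `Gal(E/F)`-equivariant.** [cite: CasselsFrohlichANT1967, Ch. VII §1.1] -/
theorem blockHom_smul (σ : E ≃ₐ[F] E) (x : ideleGroup E) :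
    blockHom F E v (σ • x) = σ • blockHom F E v x := by
  apply Units.ext; funext w
  rw [blockHom_apply, snd_smul_apply, SemiLocal.val_smul_units, SemiLocal.smul_apply, blockHom_apply]
  rfl

/-! ### Ideles with a prescribed block of units -/

section OfBlock

open scoped Classical

/-- The finite adele which is `z_w` above `v` and `1` at the other finite places, for a block `z`
of integral components. [folklore] -/
def ofBlockFinite (z : SemiLocal F E v) (hz : ∀ w, Valued.v (z w) ≤ 1) : FiniteAdeleRing (𝓞 E) E :=
  RestrictedProduct.mk
    (fun w : HeightOneSpectrum (𝓞 E) =>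
      if h : w.under (𝓞 F) = v then z ⟨w, h⟩ else (1 : w.adicCompletion E))
    (Filter.Eventually.of_forall fun w => by
      by_cases h : w.under (𝓞 F) = v
      · simp only [h, ↓reduceDIte]
        exact (HeightOneSpectrum.mem_adicCompletionIntegers _ _ _).mpr (hz ⟨w, h⟩)
      · simp only [h, ↓reduceDIte]
        exact one_mem _)

omit [NumberField F] in
/-- Components of `ofBlockFinite` above `v`. [folklore] -/
theorem ofBlockFinite_apply_of_eq (z : SemiLocal F E v) (hz : ∀ w, Valued.v (z w) ≤ 1)
    {w : HeightOneSpectrum (𝓞 E)} (h : w.under (𝓞 F) = v) :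
    ofBlockFinite z hz w = z ⟨w, h⟩ := by
  show (if h : w.under (𝓞 F) = v then z ⟨w, h⟩ else (1 : w.adicCompletion E)) = z ⟨w, h⟩
  rw [dif_pos h]

omit [NumberField F] in
/-- Components of `ofBlockFinite` away from `v`. [folklore] -/
theorem ofBlockFinite_apply_of_ne (z : SemiLocal F E v) (hz : ∀ w, Valued.v (z w) ≤ 1)
    {w : HeightOneSpectrum (𝓞 E)} (h : w.under (𝓞 F) ≠ v) : ofBlockFinite z hz w = 1 := by
  show (if h : w.under (𝓞 F) = v then z ⟨w, h⟩ else (1 : w.adicCompletion E)) = 1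
  rw [dif_neg h]

omit [NumberField F] in
/-- Integrality of the components of a block of units. [folklore] -/
theorem valued_le_one_of_mem_unitGroup {z : (SemiLocal F E v)ˣ} (hz : z ∈ SemiLocal.unitGroup F E v)
    (w : SemiLocal.Place F E v) : Valued.v ((z : SemiLocal F E v) w) ≤ 1 := (hz w).le

/-- **The idele with block `z ∈ ∏_{w ∣ v} 𝒪_wˣ` above `v` and `1` elsewhere.** [folklore] -/
def ofBlock (z : (SemiLocal F E v)ˣ) (hz : z ∈ SemiLocal.unitGroup F E v) : ideleGroup E where
  val := (1, ofBlockFinite (z : SemiLocal F E v) (valued_le_one_of_mem_unitGroup hz))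
  inv := (1, ofBlockFinite ((z⁻¹ : (SemiLocal F E v)ˣ) : SemiLocal F E v)
    (valued_le_one_of_mem_unitGroup ((SemiLocal.unitGroup F E v).inv_mem hz)))
  val_inv := by
    refine Prod.ext (mul_one _) (FiniteAdeleRing.ext E fun w => ?_)
    show ofBlockFinite _ (valued_le_one_of_mem_unitGroup hz) w *
      ofBlockFinite _ (valued_le_one_of_mem_unitGroup ((SemiLocal.unitGroup F E v).inv_mem hz)) w = 1
    by_cases h : w.under (𝓞 F) = v
    · rw [ofBlockFinite_apply_of_eq _ _ h, ofBlockFinite_apply_of_eq _ _ h]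
      show ((z : SemiLocal F E v) * ((z⁻¹ : (SemiLocal F E v)ˣ) : SemiLocal F E v)) ⟨w, h⟩ = 1
      rw [← Units.val_mul, mul_inv_cancel, Units.val_one]; rfl
    · rw [ofBlockFinite_apply_of_ne _ _ h, ofBlockFinite_apply_of_ne _ _ h, mul_one]
  inv_val := by
    refine Prod.ext (mul_one _) (FiniteAdeleRing.ext E fun w => ?_)
    show ofBlockFinite _ (valued_le_one_of_mem_unitGroup ((SemiLocal.unitGroup F E v).inv_mem hz)) w *
      ofBlockFinite _ (valued_le_one_of_mem_unitGroup hz) w = 1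
    by_cases h : w.under (𝓞 F) = v
    · rw [ofBlockFinite_apply_of_eq _ _ h, ofBlockFinite_apply_of_eq _ _ h]
      show (((z⁻¹ : (SemiLocal F E v)ˣ) : SemiLocal F E v) * (z : SemiLocal F E v)) ⟨w, h⟩ = 1
      rw [← Units.val_mul, inv_mul_cancel, Units.val_one]; rfl
    · rw [ofBlockFinite_apply_of_ne _ _ h, ofBlockFinite_apply_of_ne _ _ h, mul_one]

omit [NumberField F] in
/-- Infinite part of `ofBlock`. [folklore] -/
@[simp] theorem ofBlock_fst (z : (SemiLocal F E v)ˣ) (hz : z ∈ SemiLocal.unitGroup F E v) :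
    ((ofBlock z hz : ideleGroup E) : AdeleRing (𝓞 E) E).1 = 1 := rfl

omit [NumberField F] in
/-- Finite components of `ofBlock` above `v`. [folklore] -/
theorem ofBlock_snd_apply_of_eq (z : (SemiLocal F E v)ˣ) (hz : z ∈ SemiLocal.unitGroup F E v)
    {w : HeightOneSpectrum (𝓞 E)} (h : w.under (𝓞 F) = v) :
    ((ofBlock z hz : ideleGroup E) : AdeleRing (𝓞 E) E).2 w = (z : SemiLocal F E v) ⟨w, h⟩ :=
  ofBlockFinite_apply_of_eq _ (valued_le_one_of_mem_unitGroup hz) h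

omit [NumberField F] in
/-- Finite components of `ofBlock` away from `v`. [folklore] -/
theorem ofBlock_snd_apply_of_ne (z : (SemiLocal F E v)ˣ) (hz : z ∈ SemiLocal.unitGroup F E v)
    {w : HeightOneSpectrum (𝓞 E)} (h : w.under (𝓞 F) ≠ v) :
    ((ofBlock z hz : ideleGroup E) : AdeleRing (𝓞 E) E).2 w = 1 :=
  ofBlockFinite_apply_of_ne _ (valued_le_one_of_mem_unitGroup hz) h

omit [NumberField F] in
/-- `blockHom (ofBlock z) = z`. [folklore] -/
theorem blockHom_ofBlock (z : (SemiLocal F E v)ˣ) (hz : z ∈ SemiLocal.unitGroup F E v) :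
    blockHom F E v (ofBlock z hz) = z := by
  apply Units.ext; funext w
  rw [blockHom_apply, ofBlock_snd_apply_of_eq z hz w.under_eq]
  rfl

end OfBlock

/-! ### The local unit ideles `∏_{w ∣ v} 𝒰_w ⊆ J_E` -/

variable (F E v) in
/-- **Childress's `∏_{w ∣ v} 𝒰_w` inside `J_E`**: the ideles which are `1` at the infinite places
and at the finite places not above `v`, and local units above `v`.
[cite: Childress2009, Ch. 4 §5 (PDF p. 92)] -/
def localUnitIdeles : Subgroup (ideleGroup E) where
  carrier := {x | (x : AdeleRing (𝓞 E) E).1 = 1 ∧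
    (∀ w : HeightOneSpectrum (𝓞 E), w.under (𝓞 F) ≠ v → (x : AdeleRing (𝓞 E) E).2 w = 1) ∧
    ∀ w : HeightOneSpectrum (𝓞 E), Valued.v ((x : AdeleRing (𝓞 E) E).2 w) = 1}
  one_mem' := ⟨rfl, fun w _ => rfl, fun w => by
    show Valued.v ((1 : FiniteAdeleRing (𝓞 E) E) w) = 1
    exact (map_one _)⟩
  mul_mem' := fun {x y} hx hy => ⟨by rw [ideleGroup_val_fst_mul, hx.1, hy.1, mul_one],
    fun w hw => by rw [snd_mul_apply, hx.2.1 w hw, hy.2.1 w hw, mul_one],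
    fun w => by rw [snd_mul_apply, map_mul, hx.2.2 w, hy.2.2 w, mul_one]⟩
  inv_mem' := fun {x} hx => ⟨by
      have := ideleGroup_val_inv_fst_mul x
      rwa [hx.1, mul_one] at this,
    fun w hw => by rw [snd_inv_apply, hx.2.1 w hw, inv_one],
    fun w => by rw [snd_inv_apply, map_inv₀, hx.2.2 w, inv_one]⟩

omit [NumberField F] in
/-- Membership in `localUnitIdeles`. [folklore] -/
theorem mem_localUnitIdeles_iff {x : ideleGroup E} :
    x ∈ localUnitIdeles F E v ↔ (x : AdeleRing (𝓞 E) E).1 = 1 ∧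
      (∀ w : HeightOneSpectrum (𝓞 E), w.under (𝓞 F) ≠ v → (x : AdeleRing (𝓞 E) E).2 w = 1) ∧
      ∀ w : HeightOneSpectrum (𝓞 E), Valued.v ((x : AdeleRing (𝓞 E) E).2 w) = 1 := Iff.rfl

omit [NumberField F] in
/-- `ofBlock z ∈ localUnitIdeles`. [folklore] -/
theorem ofBlock_mem (z : (SemiLocal F E v)ˣ) (hz : z ∈ SemiLocal.unitGroup F E v) :
    ofBlock z hz ∈ localUnitIdeles F E v := by
  refine ⟨rfl, fun w hw => ofBlock_snd_apply_of_ne z hz hw, fun w => ?_⟩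
  by_cases h : w.under (𝓞 F) = v
  · rw [ofBlock_snd_apply_of_eq z hz h]; exact hz ⟨w, h⟩
  · rw [ofBlock_snd_apply_of_ne z hz h, map_one]

omit [NumberField F] in
/-- The block of an element of `localUnitIdeles` lies in `∏ 𝒪_wˣ`. [folklore] -/
theorem blockHom_mem_unitGroup {x : ideleGroup E} (hx : x ∈ localUnitIdeles F E v) :
    blockHom F E v x ∈ SemiLocal.unitGroup F E v := fun w => by
  rw [blockHom_apply]; exact hx.2.2 _

omit [NumberField F] in
/-- An element of `localUnitIdeles` is `ofBlock` of its block. [folklore] -/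
theorem ofBlock_blockHom {x : ideleGroup E} (hx : x ∈ localUnitIdeles F E v) :
    ofBlock (blockHom F E v x) (blockHom_mem_unitGroup hx) = x := by
  apply Units.ext
  refine Prod.ext (by rw [ofBlock_fst, hx.1]) (FiniteAdeleRing.ext E fun w => ?_)
  by_cases h : w.under (𝓞 F) = v
  · rw [ofBlock_snd_apply_of_eq _ _ h]; rfl
  · rw [ofBlock_snd_apply_of_ne _ _ h, hx.2.1 w h]

omit [NumberField F] in
/-- **`localUnitIdeles = ofBlock (∏ 𝒪_wˣ)`**, i.e. `blockHom` maps `localUnitIdeles` onto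
`SemiLocal.unitGroup`. [folklore] -/
theorem map_blockHom_localUnitIdeles :
    (localUnitIdeles F E v).map (blockHom F E v) = SemiLocal.unitGroup F E v := by
  apply le_antisymm
  · rintro _ ⟨x, hx, rfl⟩; exact blockHom_mem_unitGroup hx
  · intro z hz; exact ⟨ofBlock z hz, ofBlock_mem z hz, blockHom_ofBlock z hz⟩

omit [NumberField F] in
/-- `blockHom` is injective on `localUnitIdeles`. [folklore] -/
theorem localUnitIdeles_inf_ker_blockHom :
    localUnitIdeles F E v ⊓ (blockHom F E v).ker = ⊥ := by
  rw [eq_bot_iff]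
  rintro x ⟨hx, hker⟩
  rw [Subgroup.mem_bot, ← ofBlock_blockHom hx]
  have : blockHom F E v x = 1 := hker
  simp only [this]
  apply Units.ext
  refine Prod.ext rfl (FiniteAdeleRing.ext E fun w => ?_)
  by_cases h : w.under (𝓞 F) = v
  · rw [ofBlock_snd_apply_of_eq _ _ h]; rfl
  · rw [ofBlock_snd_apply_of_ne _ _ h]; rfl

/-- `localUnitIdeles` is `Gal(E/F)`-stable. [cite: CasselsFrohlichANT1967, Ch. VII §1.1] -/
theorem isStable_localUnitIdeles : Herbrand.IsStable (E ≃ₐ[F] E) (localUnitIdeles F E v) := by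
  intro σ x hx
  refine ⟨by rw [fst_smul, hx.1, smul_one], fun w hw => ?_, fun w => ?_⟩
  · rw [snd_smul_apply, hx.2.1 _ (by rwa [HeightOneSpectrum.under_algEquiv_smul]), map_one]
  · rw [snd_smul_apply, valued_galAdicCompletionMap]; exact hx.2.2 _

/-- **`Ĥ⁰` of `∏_{w ∣ v} 𝒰_w ⊆ J_E` is that of `∏_{w ∣ v} 𝒪_wˣ`** (equivariant transport along the
block projection). [cite: Childress2009, Ch. 4 §5 Prop. 5.7 (i) (PDF p. 98)] -/
theorem h0_localUnitIdeles_eq [IsGalois F E] (σ : E ≃ₐ[F] E) :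
    Herbrand.h0 σ (localUnitIdeles F E v) ⊥ = Herbrand.h0 σ (SemiLocal.unitGroup F E v) ⊥ := by
  have h := Herbrand.h0_map_eq (σ := σ) (blockHom F E v) (fun g y => blockHom_smul g y)
    (isStable_localUnitIdeles (v := v)) Herbrand.IsStable.bot bot_le
    (by rw [localUnitIdeles_inf_ker_blockHom])
  rw [map_blockHom_localUnitIdeles, Subgroup.map_bot] at h
  exact h.symm

/-- **`Ĥ⁻¹` of `∏_{w ∣ v} 𝒰_w ⊆ J_E` is that of `∏_{w ∣ v} 𝒪_wˣ`.**
[cite: Childress2009, Ch. 4 §5 Prop. 5.7 (i) (PDF p. 98)] -/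
theorem h1_localUnitIdeles_eq [IsGalois F E] (σ : E ≃ₐ[F] E) :
    Herbrand.h1 σ (localUnitIdeles F E v) ⊥ = Herbrand.h1 σ (SemiLocal.unitGroup F E v) ⊥ := by
  have h := Herbrand.h1_map_eq (σ := σ) (blockHom F E v) (fun g y => blockHom_smul g y)
    (isStable_localUnitIdeles (v := v)) Herbrand.IsStable.bot bot_le
    (by rw [localUnitIdeles_inf_ker_blockHom])
  rw [map_blockHom_localUnitIdeles, Subgroup.map_bot] at h
  exact h.symm

/-- **Childress Prop. 5.7 (i) in `J_E`**: for cyclic `Gal(E/F) = ⟨σ⟩`,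
`#Ĥ⁰(G, ∏_{w ∣ v} 𝒰_w) = #Ĥ⁻¹(G, ∏_{w ∣ v} 𝒰_w) ≠ 0`.
[cite: Childress2009, Ch. 4 §5 Prop. 5.7 (i) (PDF p. 98)] -/
theorem h0_localUnitIdeles_eq_h1 [IsGalois F E] {σ : E ≃ₐ[F] E}
    (hσ : ∀ τ : E ≃ₐ[F] E, τ ∈ Subgroup.zpowers σ) :
    Herbrand.h0 σ (localUnitIdeles F E v) ⊥ = Herbrand.h1 σ (localUnitIdeles F E v) ⊥ ∧
      Herbrand.h0 σ (localUnitIdeles F E v) ⊥ ≠ 0 := by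
  rw [h0_localUnitIdeles_eq, h1_localUnitIdeles_eq]
  exact SemiLocal.h0_unitGroup_eq_h1 hσ

/-! ### The ideles trivial at the finite places -/

variable (E) in
/-- The ideles equal to `1` at every finite place (the image of `(E_∞)ˣ`, Childress's
`∏_{w ∣ ∞} 𝒰_w`). [cite: Childress2009, Ch. 4 §5 (PDF p. 92)] -/
def infIdeles : Subgroup (ideleGroup E) where
  carrier := {x | (x : AdeleRing (𝓞 E) E).2 = 1}
  one_mem' := rfl
  mul_mem' := fun {x y} hx hy => by
    show (x : AdeleRing (𝓞 E) E).2 * (y : AdeleRing (𝓞 E) E).2 = 1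
    rw [hx, hy, mul_one]
  inv_mem' := fun {x} hx => by
    have h : ((x⁻¹ * x : ideleGroup E) : AdeleRing (𝓞 E) E).2 = 1 := by rw [inv_mul_cancel]; rfl
    have h' : ((x⁻¹ : ideleGroup E) : AdeleRing (𝓞 E) E).2 * (x : AdeleRing (𝓞 E) E).2 = 1 := h
    rw [hx, mul_one] at h'
    exact h'

/-- Membership in `infIdeles`. [folklore] -/
theorem mem_infIdeles_iff {x : ideleGroup E} : x ∈ infIdeles E ↔ (x : AdeleRing (𝓞 E) E).2 = 1 := Iff.rfl

variable (E) in
/-- The projection `J_E →* (E_∞)ˣ`. [folklore] -/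
def infHom : ideleGroup E →* (InfiniteAdeleRing E)ˣ :=
  Units.map (RingHom.fst (InfiniteAdeleRing E) (FiniteAdeleRing (𝓞 E) E)).toMonoidHom

omit [NumberField F] in
/-- `infHom` is `Gal(E/F)`-equivariant. [folklore] -/
theorem infHom_smul (σ : E ≃ₐ[F] E) (x : ideleGroup E) : infHom E (σ • x) = σ • infHom E x := rfl

/-- `infHom ∘ infiniteIdeles = id`. [folklore] -/
theorem infHom_infiniteIdeles (y : (InfiniteAdeleRing E)ˣ) : infHom E (infiniteIdeles E y) = y :=
  Units.ext rfl

/-- `infiniteIdeles y ∈ infIdeles`. [folklore] -/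
theorem infiniteIdeles_mem (y : (InfiniteAdeleRing E)ˣ) : infiniteIdeles E y ∈ infIdeles E := rfl

/-- `infHom` maps `infIdeles` onto `(E_∞)ˣ`. [folklore] -/
theorem map_infHom_infIdeles : (infIdeles E).map (infHom E) = ⊤ := by
  rw [eq_top_iff]
  intro y _
  exact ⟨infiniteIdeles E y, infiniteIdeles_mem y, infHom_infiniteIdeles y⟩

/-- `infHom` is injective on `infIdeles`. [folklore] -/
theorem infIdeles_inf_ker_infHom : infIdeles E ⊓ (infHom E).ker = ⊥ := by
  rw [eq_bot_iff]
  rintro x ⟨hx, hker⟩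
  rw [Subgroup.mem_bot]
  have h1 : (x : AdeleRing (𝓞 E) E).1 = 1 := congrArg Units.val (show infHom E x = 1 from hker)
  exact Units.ext (Prod.ext h1 hx)

omit [NumberField F] in
/-- `infIdeles` is `Gal(E/F)`-stable. [folklore] -/
theorem isStable_infIdeles : Herbrand.IsStable (E ≃ₐ[F] E) (infIdeles E) := by
  intro σ x hx
  show (σ • (x : AdeleRing (𝓞 E) E)).2 = 1
  rw [AdeleRing.smul_snd, hx, smul_one]

/-- **`Ĥ⁰` of the ideles trivial at finite places is that of `(E_∞)ˣ`.** [folklore] -/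
theorem h0_infIdeles_eq (σ : E ≃ₐ[F] E) :
    Herbrand.h0 σ (infIdeles E) ⊥ = Herbrand.h0 σ (⊤ : Subgroup (InfiniteAdeleRing E)ˣ) ⊥ := by
  have h := Herbrand.h0_map_eq (σ := σ) (infHom E) (fun g y => infHom_smul g y)
    (isStable_infIdeles (F := F)) Herbrand.IsStable.bot bot_le (by rw [infIdeles_inf_ker_infHom])
  rw [map_infHom_infIdeles, Subgroup.map_bot] at h
  exact h.symm

/-- **`Ĥ⁻¹` of the ideles trivial at finite places is that of `(E_∞)ˣ`.** [folklore] -/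
theorem h1_infIdeles_eq (σ : E ≃ₐ[F] E) :
    Herbrand.h1 σ (infIdeles E) ⊥ = Herbrand.h1 σ (⊤ : Subgroup (InfiniteAdeleRing E)ˣ) ⊥ := by
  have h := Herbrand.h1_map_eq (σ := σ) (infHom E) (fun g y => infHom_smul g y)
    (isStable_infIdeles (F := F)) Herbrand.IsStable.bot bot_le (by rw [infIdeles_inf_ker_infHom])
  rw [map_infHom_infIdeles, Subgroup.map_bot] at h
  exact h.symm

end IdeleHerbrand

end Literature.NumberTheory.GaloisRepresentations
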